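import Mathlib
import Literature.Computability.MetaComplexity.McKayMurrayWilliams2019.UniformStreaming
import Summits.PneNP.PneNP.Theorems.SoloBlindAnchor
import Summits.PneNP.PneNP.Theorems.SoloBlindStreamCollapse
import Summits.PneNP.PneNP.Theorems.SoloBlindSparseStreaming
import HarnessLib

/-!
# Corridor B end to end: a uniform streaming lower bound for `MCSP[s]` gives the summit `PneNP`

Solo seat `solo-PneNP-blind` (blind mode). Consumes the Literature reproduction
`Literature/Computability/MetaComplexity/McKayMurrayWilliams2019/UniformStreaming.lean`
(uniform one-pass streaming class `USTREAM`, hypothesis shape `StreamingLowerBound`, named fact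
`thm13` = McKay–Murray–Williams STOC 2019 Thm. 1.3) and the anchor `PneNP ↔ P ≠ NP`:

* `SoloBlind.pneNP_of_streamingLowerBound` — `thm13 → IsTimeConstructible s →
  StreamingLowerBound s → PneNP`: the typed missing input of the magnification corridor.
* `SoloBlind.USTREAM_subset_STREAM` — `USTREAM S T ⊆ STREAM S (5 S + 10)`: the uniform class sits
  inside the tree's non-uniform one (whose time parameter is inert, `SoloBlindStreamCollapse`);
  together with `SoloBlind.nonuniform_streamingLowerBound_false` (`SoloBlindSparseStreaming`):
  the information-theoretic shadow of the hypothesis is false, so a proof of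
  `StreamingLowerBound s` must use the uniformity (bounded program size) of the update machine.

References: McKay–Murray–Williams, STOC 2019, Thm. 1.3, §2, §5 [doi:10.1145/3313276.3316396].
-/

namespace Summit.PneNP.PneNP.Theorems

open Literature.Computability.Complexity Literature.Computability.MetaComplexity
  Literature.Computability.MetaComplexity.McKayMurrayWilliams2019

namespace SoloBlind

/-- **Corridor B, typed.** McKay–Murray–Williams Thm. 1.3 (named fact `thm13`) turns a uniform
one-pass streaming lower bound for `MCSP[s]` — `StreamingLowerBound s`: for every `c`, no uniform
streaming algorithm with space and update/report time `s(⌊log₂N⌋)^c + c` — for a single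
time-constructible `s` into the summit `PneNP`. -/
theorem pneNP_of_streamingLowerBound (h : thm13) {s : ℕ → ℕ} (hs : IsTimeConstructible s)
    (hlb : StreamingLowerBound s) : PneNP :=
  SoloBlind.pneNP_iff_P_ne_NP.2 (P_ne_NP_of_streamingLowerBound h hs hlb)

/-- Truncating the update map of `A` at the space bound: agrees with `A` along every run that
respects the bound, and satisfies the tree's all-states space predicate `HasSpace`. -/
def truncate (A : StreamingAlgorithm) (S : ℕ → ℕ) : StreamingAlgorithm where
  init _ := []
  update N st b := (A.update N st b).take (S N)
  accept := A.accept

/-- The truncated algorithm has space `S` in the tree's (all-states) sense. -/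
theorem hasSpace_truncate (A : StreamingAlgorithm) (S : ℕ → ℕ) : (truncate A S).HasSpace S :=
  fun N => ⟨by simp [truncate], fun st b _ => by simp [truncate, List.length_take]⟩

/-- Along runs within the space bound the truncation changes nothing. -/
theorem reach_truncate {A : StreamingAlgorithm} {S : ℕ → ℕ} (h0 : ∀ N, A.init N = [])
    (hS : RunsInSpace A S) (N : ℕ) :
    ∀ x : List Bool, x.length ≤ N → reach (truncate A S) N x = reach A N x := by
  intro x
  induction x using List.reverseRecOn with
  | nil => intro _; simp [reach_nil, truncate, h0]
  | append_singleton x b ih =>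
    intro hx
    have hx' : x.length ≤ N := by simp at hx; omega
    rw [reach_append_singleton, reach_append_singleton, ih hx']
    show (A.update N (reach A N x) b).take (S N) = A.update N (reach A N x) b
    rw [← reach_append_singleton]
    exact List.take_of_length_le (hS N (x ++ [b]) hx)

/-- **`USTREAM S T ⊆ STREAM S (5 S + 10)`.** A uniform streaming decider with space `S` on runs is,
after truncation, a decider with space `S` on all states; the tree's class then imposes no
genuine time constraint (`mem_STREAM_of_hasSpace`). -/
theorem USTREAM_subset_STREAM (S T : ℕ → ℕ) :
    USTREAM S T ⊆ STREAM S (fun N => 5 * S N + 10) := by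
  rintro L ⟨A, h0, hS, -, -, hD⟩
  refine mem_STREAM_of_hasSpace ⟨truncate A S, hasSpace_truncate A S, fun x => ?_⟩ fun _ => le_rfl
  have hfin : (truncate A S).finalState x = A.finalState x := by
    rw [finalState_eq_reach, finalState_eq_reach]
    exact reach_truncate h0 hS x.length x le_rfl
  rw [← hD x]
  simp only [StreamingAlgorithm.Accepts, hfin]
  rfl

/-- **What the uniformity buys, in one statement.** For `s(n) ≥ n` the NON-UNIFORM shadow of
`StreamingLowerBound s` fails (some `S, T ≤ s(⌊log₂N⌋)^105 + 105` have `MCSP[s] ∈ STREAM S T`),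
while the uniform statement implies `PneNP` (given `thm13`). -/
theorem streamingLowerBound_dichotomy (s : ℕ → ℕ) (hs : IsTimeConstructible s) :
    (∃ S T : ℕ → ℕ, (∀ N, S N ≤ s (Nat.log 2 N) ^ 105 + 105 ∧ T N ≤ s (Nat.log 2 N) ^ 105 + 105) ∧
        MCSPSize s ∈ STREAM S T) ∧
      (thm13 → StreamingLowerBound s → PneNP) :=
  ⟨nonuniform_streamingLowerBound_false s hs.1, fun h hlb => pneNP_of_streamingLowerBound h hs hlb⟩

end SoloBlind

end Summit.PneNP.PneNP.Theorems
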